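import Literature.Algebra.EuclideanLattices.RegevRoutineCore
import Literature.Algebra.EuclideanLattices.RegevUSVPInstance
import Literature.Algebra.EuclideanLattices.LLLMachineMain
import HarnessLib

/-!
# Regev's reduction `uSVP ≤ DCP`: the routine's input on an instance

Sixteenth file (XIV-c) of the construction discharging `usvp_of_dihedralCoset` (Regev 2004,
Thm. 1.1). For a lattice instance `I = ⟨n, B⟩` and the failure parameter `f` we define the **input
of the per-copy routine** — the payload `(rows of 2ⁿB, p, Q, radii = powers of two)` of file IX,
coded and padded to a length `L` with `nOf L = n` (`xOf`) — and do the size bookkeeping used by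
the good data of file XIV-d:

* `plOf`, `Tof`, `radiiOf`, `codeOf`, `sOf`, `LOf`, `xOf`; `nOf_LOf`, `length_xOf`, `payloadOf_xOf`,
  `qLevels_xOf`, `radii_getD`;
* `reidx` — reindexing a basis along `m = n` and its transport lemmas (by `subst`);
* `natAbs_entry_lt` (entries `< 2^{|code|}`), `minNorm_le_two_pow`, `radA_sq_lt_two_pow` (`R² < 2ᵀ`),
  `rhoOf_lt` (the radius guess is in the table), `radius_plOf`, `numIdx_le` (`κ ≤ L²`).

## References

* O. Regev, *Quantum computation and lattice problems*, SIAM J. Comput. 33 (2004), proof of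
  Lemma 3.12 (p. 14) and of Thm. 1.1 (p. 7).
-/

noncomputable section

namespace Literature.Algebra.EuclideanLattices

namespace RegevRoutine

open _root_.Computability Literature.Computability.Complexity Literature.Computability.Cryptography
  Literature.Computability.QuantumComplexity Regev2004 Finset Polynomial

/-! ### The payload and the input of an instance -/

section Input

variable (f : ℝ) (I : LatticeInstance)

/-- The length `T` of the radius table: `2|code(B)| + (4k+8)(n+1) + 2c_A` (`> log₂ R²`). [folklore] -/
def Tof : ℕ := 2 * I.encode.length + (4 * kOf f + 8) * (I.n + 1) + 2 * cA f

/-- The radius table: the powers of two below `2ᵀ`. [cite: Regev2004, Lemma 3.12 (proof, p. 14: the guess of λ₁)] -/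
def radiiOf : List ℕ := (List.range (Tof f I)).map fun ρ => 2 ^ ρ

/-- **The payload of an instance**: the rows of `2ⁿB`, `p`, `Q`, the radius table. [cite: Regev2004, Lemma 3.12 (proof, p. 14)] -/
def plOf : Payload := (rowsOf (Jof I), (pOf f I.n, (Qof f I.n, radiiOf f I)))

/-- Its code. [folklore] -/
def codeOf : List Bool := ePayload.encode (plOf f I)

/-- The side `s` of the padding square: `2|code| + 2 + n + Q + p + T`. [folklore] -/
def sOf : ℕ := 2 * (codeOf f I).length + 2 + I.n + Qof f I.n + pOf f I.n + Tof f I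

/-- **The input length** `L = s² + n` (so that `nOf L = n`). [folklore] -/
def LOf : ℕ := sOf f I ^ 2 + I.n

/-- The padding. [folklore] -/
def padOf : List Bool := List.replicate (LOf f I - (2 * (codeOf f I).length + 2)) true

/-- **The input of the per-copy routine on an instance.** [folklore] -/
def xOf : List Bool := boolPair (codeOf f I) (padOf f I)

variable {f I}

/-- The input, unfolded. [folklore] -/
theorem xOf_eq : xOf f I = boolPair (ePayload.encode (plOf f I)) (padOf f I) := by rw [xOf, codeOf]

/-- `2|code| + 2 ≤ s ≤ L`. [folklore] -/
theorem sOf_le_LOf : sOf f I ≤ LOf f I := by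
  unfold LOf; have := Nat.le_self_pow two_ne_zero (sOf f I); omega

/-- **`|x| = L`.** [folklore] -/
@[simp] theorem length_xOf : (xOf f I).length = LOf f I := by
  have h := sOf_le_LOf (f := f) (I := I)
  unfold xOf padOf
  rw [length_boolPair, List.length_replicate]
  unfold sOf at h; omega

/-- **`nOf L = n`.** [folklore] -/
theorem nOf_LOf : nOf (LOf f I) = I.n := by
  unfold nOf LOf
  rw [Nat.sqrt_add_eq' (sOf f I) (by unfold sOf; omega)]
  omega

/-- `nOf |x| = n`. [folklore] -/
theorem nOf_length_xOf : nOf (xOf f I).length = I.n := by rw [length_xOf, nOf_LOf]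

/-- The payload is read off the input. [folklore] -/
theorem payloadOf_xOf : payloadOf (xOf f I) = plOf f I := payloadOf_input _ _

/-- `Q ≤ L`, `p ≤ L`, `T ≤ L`, `n ≤ L`. [folklore] -/
theorem sizes_le_LOf : Qof f I.n ≤ LOf f I ∧ pOf f I.n ≤ LOf f I ∧ Tof f I + 2 ≤ LOf f I ∧ I.n ≤ LOf f I := by
  have h := sOf_le_LOf (f := f) (I := I)
  unfold sOf at h
  exact ⟨by omega, by omega, by omega, by omega⟩

/-- `qLevels L pl = Q`. [folklore] -/
theorem qLevels_xOf : qLevels (xOf f I).length (plOf f I) = Qof f I.n := by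
  rw [qLevels, length_xOf]; exact min_eq_left sizes_le_LOf.1

/-- The radius table entry `ρ`. [folklore] -/
theorem radii_getD {ρ : ℕ} (hρ : ρ < Tof f I) : (plOf f I).radii.getD ρ 0 = 2 ^ ρ := by
  change (radiiOf f I).getD ρ 0 = 2 ^ ρ
  unfold radiiOf
  rw [List.getD_eq_getElem _ _ (by simpa using hρ)]
  simp

/-- Length of the radius table. [folklore] -/
@[simp] theorem length_radii : (plOf f I).radii.length = Tof f I := by
  change (radiiOf f I).length = _; simp [radiiOf]

end Input

/-! ### Reindexing a basis along `m = n` -/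

section Reidx

variable {m n : ℕ}

/-- The basis `B` reindexed along `m = n`. [folklore] -/
def reidx (h : m = n) (B : Matrix (Fin n) (Fin n) ℤ) : Matrix (Fin m) (Fin m) ℤ := fun i j => B (i.cast h) (j.cast h)

/-- Rows are unchanged by reindexing. [folklore] -/
theorem rowsOf_reidx (h : m = n) (B : Matrix (Fin n) (Fin n) ℤ) : rowsOf ⟨m, reidx h B⟩ = rowsOf ⟨n, B⟩ := by subst h; rfl

/-- Regev's fibre hypotheses transport along reindexing. [folklore] -/
theorem fiberHyp_reidx (h : m = n) {B : Matrix (Fin n) (Fin n) ℤ} {i₀ : Fin n} {p mm : ℤ} {u : Fin n → ℤ} {Q Δ : ℕ} {hΔ : 0 < Δ}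
    (H : Regev2004.FiberHyp ⟨n, B⟩ i₀ p mm u (pointSet n Q Δ hΔ)) :
    Regev2004.FiberHyp ⟨m, reidx h B⟩ (i₀.cast h.symm) p mm (fun i => u (i.cast h)) (pointSet m Q Δ hΔ) := by
  subst h; exact H

/-- Hidden shifts transport along reindexing. [folklore] -/
theorem hiddenShift_reidx (h : m = n) (i₀ : Fin n) (p mm : ℤ) (u : Fin n → ℤ) (i : Fin m) :
    hiddenShift (i₀.cast h.symm) p mm (fun i => u (i.cast h)) i = hiddenShift i₀ p mm u (i.cast h) := by subst h; rfl

/-- `dcpShift` transports along reindexing. [folklore] -/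
theorem dcpShift_reidx (h : m = n) (M : ℕ) (δ : Fin n → ℤ) : dcpShift M m (fun i => δ (i.cast h)) = dcpShift M n δ := by subst h; rfl

/-- Sums transport along reindexing. [folklore] -/
theorem sum_reidx (h : m = n) (g : Fin n → ℝ) : ∑ i : Fin m, g (i.cast h) = ∑ i : Fin n, g i := by subst h; rfl

/-- `vecMul` transports along reindexing. [folklore] -/
theorem vecMul_reidx (h : m = n) (u : Fin n → ℤ) (B : Matrix (Fin n) (Fin n) ℤ) :
    Matrix.vecMul (fun i => u (i.cast h)) (reidx h B) = fun j => Matrix.vecMul u B (j.cast h) := by subst h; rfl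

/-- Norms transport along reindexing. [folklore] -/
theorem norm_reidx (h : m = n) (v : Fin n → ℤ) : ‖intVecToEuclidean m (fun i => v (i.cast h))‖ = ‖intVecToEuclidean n v‖ := by subst h; rfl

/-- `qCount` and `pointSet` only see the dimension. [folklore] -/
theorem pointSet_congr {Q Q' Δ Δ' : ℕ} (hQ : Q = Q') (hΔ' : Δ = Δ') (h : 0 < Δ) (h' : 0 < Δ') : pointSet n Q Δ h = pointSet n Q' Δ' h' := by
  subst hQ; subst hΔ'; rfl

end Reidx

/-! ### Size bookkeeping -/

section Sizes

variable {f : ℝ} {I : LatticeInstance}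

/-- An element of a coded list is no longer than the code. [folklore] -/
theorem length_le_length_encList' {a : List Bool} : ∀ {l : List (List Bool)}, a ∈ l → a.length ≤ (encList l).length
  | [], h => by simp at h
  | b :: l, h => by
    rw [encList_cons, length_boolPair]
    rcases List.mem_cons.1 h with rfl | h
    · omega
    · have := length_le_length_encList' h; omega

/-- **Entries are below `2^{|code|}`**: the code of the instance contains the binary numeral of
`|B i j|`. [cite: MicciancioGoldwasser2002, Ch. 1 §1.2 (size of a lattice instance)] -/
theorem natAbs_entry_lt (I : LatticeInstance) (i j : Fin I.n) : (I.basis i j).natAbs < 2 ^ I.encode.length := by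
  have hcode := LLLMachine.encode_eq_record I
  have hmem : encodingIntBool.encode (I.basis i j) ∈ (List.ofFn (LLLMachine.flatEntries I.basis)).map encodingIntBool.encode := by
    refine List.mem_map.2 ⟨I.basis i j, ?_, rfl⟩
    rw [List.mem_ofFn]
    refine ⟨finProdFinEquiv (i, j), ?_⟩
    simp [LLLMachine.flatEntries]
  have h1 := length_le_length_encList' hmem
  have h2 : (encodeNat (I.basis i j).natAbs).length ≤ (encodingIntBool.encode (I.basis i j)).length := by
    rw [LLLMachine.encodingIntBool_encode_eq, length_boolPair]; omega
  have h3 : (encodingIntBool.encode (I.basis i j)).length ≤ I.encode.length := by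
    rw [hcode, length_boolPair, length_boolPair]; omega
  have h4 : (I.basis i j).natAbs < 2 ^ (encodeNat (I.basis i j).natAbs).length := by
    rw [TM2Pass.length_encodeNat_eq_size]; exact Nat.lt_size_self _
  exact h4.trans_le (Nat.pow_le_pow_right (by norm_num) (by omega))

/-- **`λ₁(L) ≤ 2^{|code| + n}`** (`λ₁ ≤ ‖b₀‖ ≤ √n · max |entry|`). [folklore] -/
theorem minNorm_le_two_pow (hI : I.IsNonsingular) (hn : 1 ≤ I.n) : minNorm I.lattice ≤ (2 : ℝ) ^ (I.encode.length + I.n) := by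
  have hb0 : I.vec ⟨0, hn⟩ ≠ 0 := (LatticeInstance.linearIndependent_vec hI).ne_zero _
  have hmem : I.vec ⟨0, hn⟩ ∈ I.lattice := Submodule.subset_span ⟨_, rfl⟩
  refine (minNorm_le_norm_of_mem hmem hb0).trans ?_
  change ‖intVecToEuclidean I.n (I.basis ⟨0, hn⟩)‖ ≤ _
  rw [norm_intVecToEuclidean]
  have hent : ∀ j, ((I.basis ⟨0, hn⟩ j : ℝ)) ^ 2 ≤ ((2 : ℝ) ^ I.encode.length) ^ 2 := fun j => by
    have h := natAbs_entry_lt I ⟨0, hn⟩ j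
    have h' : |(I.basis ⟨0, hn⟩ j : ℝ)| ≤ (2 : ℝ) ^ I.encode.length := by
      rw [← Int.cast_abs, ← Nat.cast_natAbs]; exact_mod_cast h.le
    have := sq_le_sq' (abs_le.1 h').1 (abs_le.1 h').2
    simpa using this
  have hsum : ∑ j, ((I.basis ⟨0, hn⟩ j : ℝ)) ^ 2 ≤ I.n * ((2 : ℝ) ^ I.encode.length) ^ 2 := by
    calc ∑ j, ((I.basis ⟨0, hn⟩ j : ℝ)) ^ 2 ≤ ∑ _j : Fin I.n, ((2 : ℝ) ^ I.encode.length) ^ 2 := Finset.sum_le_sum fun j _ => hent j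
      _ = I.n * ((2 : ℝ) ^ I.encode.length) ^ 2 := by simp
  have hn2 : (I.n : ℝ) ≤ ((2 : ℝ) ^ I.n) ^ 2 := by
    have : (I.n : ℝ) < (2 : ℝ) ^ I.n := by exact_mod_cast Nat.lt_two_pow_self
    have h1 : (1 : ℝ) ≤ (2 : ℝ) ^ I.n := one_le_pow₀ (by norm_num)
    nlinarith
  refine Real.sqrt_le_iff.2 ⟨by positivity, ?_⟩
  rw [pow_add]
  calc ∑ j, ((I.basis ⟨0, hn⟩ j : ℝ)) ^ 2 ≤ I.n * ((2 : ℝ) ^ I.encode.length) ^ 2 := hsum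
    _ ≤ ((2 : ℝ) ^ I.n) ^ 2 * ((2 : ℝ) ^ I.encode.length) ^ 2 := by gcongr
    _ = ((2 : ℝ) ^ I.encode.length * (2 : ℝ) ^ I.n) ^ 2 := by ring

/-- **`R² < 2ᵀ`.** [folklore] -/
theorem radA_sq_lt_two_pow (f : ℝ) (hI : I.IsNonsingular) (hn : 1 ≤ I.n) : radA f I.n (lamOf I) ^ 2 < (2 : ℝ) ^ Tof f I := by
  have hlam : lamOf I ≤ (2 : ℝ) ^ I.n * (2 : ℝ) ^ (I.encode.length + I.n) := by
    rw [lamOf_eq]; exact mul_le_mul_of_nonneg_left (minNorm_le_two_pow hI hn) (by positivity)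
  have hlam0 : 0 < lamOf I := lt_of_lt_of_le (by positivity) (lamOf_ge hI hn)
  have hnp := rpow_half_add_le_pow f hn
  have hn2 : (I.n : ℝ) < (2 : ℝ) ^ I.n := by exact_mod_cast Nat.lt_two_pow_self
  have hcA : (cA f : ℝ) < (2 : ℝ) ^ cA f := by exact_mod_cast Nat.lt_two_pow_self
  have hcA0 : (0 : ℝ) < cA f := by exact_mod_cast (show 0 < cA f by unfold cA; positivity)
  -- `R ≤ c_A n^{2k+1} λ < 2^{c_A} (2ⁿ)^{2k+1} 2ⁿ 2^{|c|+n}`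
  have hR : radA f I.n (lamOf I) < (2 : ℝ) ^ cA f * ((2 : ℝ) ^ I.n) ^ (2 * kOf f + 1) * ((2 : ℝ) ^ I.n * (2 : ℝ) ^ (I.encode.length + I.n)) := by
    unfold radA
    have h1 : (I.n : ℝ) ^ ((1 : ℝ) / 2 + 2 * f) ≤ ((2 : ℝ) ^ I.n) ^ (2 * kOf f + 1) :=
      hnp.trans (pow_le_pow_left₀ (by positivity) hn2.le _)
    have h1' : (0 : ℝ) < (I.n : ℝ) ^ ((1 : ℝ) / 2 + 2 * f) := Real.rpow_pos_of_pos (by exact_mod_cast hn) _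
    calc (cA f : ℝ) * (I.n : ℝ) ^ ((1 : ℝ) / 2 + 2 * f) * lamOf I
        < (2 : ℝ) ^ cA f * (I.n : ℝ) ^ ((1 : ℝ) / 2 + 2 * f) * lamOf I := by gcongr
      _ ≤ (2 : ℝ) ^ cA f * ((2 : ℝ) ^ I.n) ^ (2 * kOf f + 1) * ((2 : ℝ) ^ I.n * (2 : ℝ) ^ (I.encode.length + I.n)) := by gcongr
  have hR0 : 0 ≤ radA f I.n (lamOf I) := by unfold radA; positivity
  have e : (2 : ℝ) ^ cA f * ((2 : ℝ) ^ I.n) ^ (2 * kOf f + 1) * ((2 : ℝ) ^ I.n * (2 : ℝ) ^ (I.encode.length + I.n)) =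
      (2 : ℝ) ^ (cA f + I.n * (2 * kOf f + 1) + I.n + (I.encode.length + I.n)) := by
    rw [← pow_mul, ← pow_add, ← pow_add, ← pow_add]; ring_nf
  rw [e] at hR
  have hsq : radA f I.n (lamOf I) ^ 2 < ((2 : ℝ) ^ (cA f + I.n * (2 * kOf f + 1) + I.n + (I.encode.length + I.n))) ^ 2 :=
    pow_lt_pow_left₀ hR hR0 two_ne_zero
  refine hsq.trans_le ?_
  rw [← pow_mul]
  refine pow_le_pow_right₀ (by norm_num) ?_
  unfold Tof; nlinarith

/-- **The radius index is in the table**: `ρ₀ < T`. [folklore] -/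
theorem rhoOf_lt (hf : 0 < f) (h : NumOK f I.n) (hI : I.IsNonsingular) : Regev2004.rhoOf f I < Tof f I := by
  have hn1 : 1 ≤ I.n := by have := h.four_le; omega
  have hw := (Regev2004.window (I := I) hf h hI).2
  have hT := radA_sq_lt_two_pow f hI hn1
  have hQ1 : (1 : ℝ) ≤ Qof f I.n := by exact_mod_cast (show 1 ≤ Qof f I.n by have := two_mul_le_Qof f I.n; omega)
  have h2 : ((2 : ℕ) ^ Regev2004.rhoOf f I : ℝ) < (2 : ℝ) ^ Tof f I := by
    have : ((ΔOf f I : ℕ) : ℝ) ≤ (Qof f I.n : ℝ) * ΔOf f I := le_mul_of_one_le_left (Nat.cast_nonneg _) hQ1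
    unfold ΔOf at this hw; push_cast at this hw ⊢; linarith
  have h3 : (2 : ℕ) ^ Regev2004.rhoOf f I < 2 ^ Tof f I := by exact_mod_cast h2
  exact (Nat.pow_lt_pow_iff_right (by norm_num)).1 h3

/-- `radius pl G = Δ` for the right radius guess. [folklore] -/
theorem radius_plOf {G : Guess} (hG : G.rho = Regev2004.rhoOf f I) (hf : 0 < f) (h : NumOK f I.n) (hI : I.IsNonsingular) :
    radius (plOf f I) G = ΔOf f I := by
  rw [radius, hG, radii_getD (rhoOf_lt hf h hI)]
  unfold ΔOf; exact max_eq_right (Nat.one_le_two_pow)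

/-- **The index coins fit**: `numIdx ≤ L²`. [folklore] -/
theorem numIdx_le {G : Guess} (hG : G.rho = Regev2004.rhoOf f I) (hf : 0 < f) (h : NumOK f I.n) (hI : I.IsNonsingular) :
    numIdx (xOf f I).length (plOf f I) G ≤ LOf f I * LOf f I := by
  have hn1 : 1 ≤ I.n := by have := h.four_le; omega
  obtain ⟨hQL, -, hTL, hnL⟩ := sizes_le_LOf (f := f) (I := I)
  rw [numIdx, radius_plOf hG hf h hI, nOf_length_xOf, qLevels_xOf]
  -- `QΔ < 2ᵀ`
  have hw := (Regev2004.window (I := I) hf h hI).2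
  have hT := radA_sq_lt_two_pow f hI hn1
  have hQΔ : Qof f I.n * ΔOf f I < 2 ^ Tof f I := by
    have : ((Qof f I.n * ΔOf f I : ℕ) : ℝ) < (2 : ℝ) ^ Tof f I := by push_cast; linarith
    exact_mod_cast this
  have hb : bLev (ΔOf f I) (Qof f I.n) < 2 ^ Tof f I := (Nat.sqrt_le_self _).trans_lt hQΔ
  have hq := qCount_le_pow (ΔOf_pos f I) I.n (Qof f I.n)
  have h2 : 2 * bLev (ΔOf f I) (Qof f I.n) + 1 ≤ 2 ^ (Tof f I + 2) := by rw [pow_add]; omega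
  have h3 : qCount (ΔOf f I) I.n (Qof f I.n) ≤ 2 ^ ((Tof f I + 2) * I.n) := by
    rw [pow_mul]; exact hq.trans (Nat.pow_le_pow_left h2 _)
  calc Nat.log 2 (qCount (ΔOf f I) I.n (Qof f I.n)) ≤ Nat.log 2 (2 ^ ((Tof f I + 2) * I.n)) := Nat.log_mono_right h3
    _ = (Tof f I + 2) * I.n := Nat.log_pow (by norm_num) _
    _ ≤ LOf f I * LOf f I := Nat.mul_le_mul hTL hnL

end Sizes

end RegevRoutine

end Literature.Algebra.EuclideanLattices

end
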